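import Summits.Ventures.PercRepro.RankDistTightParallel

/-!
# PercRepro — the cumulative shadow inequality on the tight layer: the shadow of a PARALLEL PAIR counted, and the
reduction (p9, gen 19)

With `RankDistTightParallel` (a bottom set of the tight layer contains exactly one element of a parallel pair
`{x, x'}`; the rank bookkeeping of the minor `M ／ x ＼ x'`): removing `{x, x'}` from a shadow set of rank `u + 1`
of `M` gives a shadow set of rank `u` of the minor (`mem_shadowLev_parallel_iff`), with the three non-empty parts
of `{x, x'}` as the fibres — **`card_shadowLev_parallel`**: `s_{u+1}(M; p+1, q+1) = 3·s_u(M ／ x ＼ x'; p, q)` for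
every `u`. With the binomial comparison `C(p+q+2, v+1)·C(p+q, q) ≤ C(p+q+2, q+1)·C(p+q, v)`
(`choose_mul_choose_le_choose_mul_choose`, `RankDistMinor`) this gives **`shadowCumulative_of_parallel`**:
`ShadowCumulative (M ／ x ＼ x') p q` implies `ShadowCumulative M (p+1) (q+1)` on the tight layer `|E| = p + q + 2`
— the cumulative shadow inequality (row C-048) on the tight layer reduces to matroids without parallel pairs
(the minor is again on the tight layer: `gr_parallelMinor`). Nothing here is a statement about any window of the
crux.
-/

namespace PercRepro.RankDist

open Set Finset _root_.Matroid PercRepro.ThmH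

variable {α : Type} [DecidableEq α] (M : Matroid α) [M.Finite]

section ParallelPair

variable {x x' : α}

/-- **Shadow sets of `M` ↔ shadow sets of the minor** (tight layer): `A` is a rank-`(u+1)` shadow set of
`(p+1, q+1)` iff `A ⊆ E` meets `{x, x'}` and `A ∖ {x, x'}` is a rank-`u` shadow set of `(p, q)` in `M ／ x ＼ x'`. -/
theorem mem_shadowLev_parallel_iff {p q u : ℕ} (hn : (gr M).card = p + q + 2) (hx : M.IsNonloop x)
    (hx' : M.IsNonloop x') (hxx' : x' ∈ M.closure {x}) (hne : x ≠ x') {A : Set α} :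
    A ∈ shadowLev M (u + 1) (PerFlat.Uq M (p + 1) (q + 1)) ↔
      A ⊆ M.E ∧ (x ∈ A ∨ x' ∈ A) ∧
        A \ {x, x'} ∈ shadowLev ((M.contract {x}).delete {x'}) u
          (PerFlat.Uq ((M.contract {x}).delete {x'}) p q) := by
  rw [mem_shadowLev, mem_shadowLev]
  constructor
  · rintro ⟨hAE, hAu, B, hB, hBA⟩
    have hA₀E : A \ {x, x'} ⊆ ((M.contract {x}).delete {x'}).E := by
      rw [parallelMinor_ground]; exact Set.sdiff_subset_sdiff_left hAE
    -- the one element of the pair in `B`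
    obtain ⟨y, y', hyy', hyB, hy'B⟩ : ∃ y y', ((y = x ∧ y' = x') ∨ (y = x' ∧ y' = x)) ∧ y ∈ B ∧ y' ∉ B := by
      rcases mem_Uq_parallel M hn hx hx' hxx' hne hB with ⟨h1, h2⟩ | ⟨h1, h2⟩
      · exact ⟨x, x', Or.inl ⟨rfl, rfl⟩, h1, h2⟩
      · exact ⟨x', x, Or.inr ⟨rfl, rfl⟩, h2, h1⟩
    have hyA : y ∈ A := hBA (Finset.mem_coe.2 hyB)
    have hA : x ∈ A ∨ x' ∈ A := by
      rcases hyy' with ⟨rfl, -⟩ | ⟨rfl, -⟩ <;> [exact Or.inl hyA; exact Or.inr hyA]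
    refine ⟨hAE, hA, hA₀E, ?_, B.erase y, ?_, ?_⟩
    · -- the rank drops by one
      rw [rk_eq_iff _ hA₀E]
      have h := eRk_eq_parallelMinor_add_one M hx hx' hxx' hAE hA
      rw [eRk_eq_coe_rk M hAE, hAu] at h
      have h' : ((M.contract {x}).delete {x'}).eRk (A \ {x, x'}) + 1 = (u : ℕ∞) + 1 := by
        rw [← h]; push_cast; rfl
      exact WithTop.add_right_cancel WithTop.one_ne_top h'
    · -- the bottom set minus `y` is a bottom set of the minor
      have hBE : B ⊆ gr M := (PerFlat.mem_Uq.1 hB).1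
      have hB₀ : B.erase y ⊆ gr ((M.contract {x}).delete {x'}) := by
        intro z hz
        rw [Finset.mem_erase] at hz
        rw [gr_parallelMinor, Finset.mem_erase, Finset.mem_erase]
        rcases hyy' with ⟨rfl, rfl⟩ | ⟨rfl, rfl⟩
        · exact ⟨fun h => hy'B (h ▸ hz.2), hz.1, hBE hz.2⟩
        · exact ⟨hz.1, fun h => hy'B (h ▸ hz.2), hBE hz.2⟩
      rw [← insert_mem_Uq_iff_parallel M hx hx' hxx' hne hyy' hB₀, Finset.insert_erase hyB]
      exact hB
    · -- and it lies inside `A ∖ {x, x'}`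
      intro z hz
      rw [Finset.mem_coe, Finset.mem_erase] at hz
      refine ⟨hBA (Finset.mem_coe.2 hz.2), fun h => ?_⟩
      simp only [Set.mem_insert_iff, Set.mem_singleton_iff] at h
      rcases hyy' with ⟨rfl, rfl⟩ | ⟨rfl, rfl⟩
      · exact h.elim hz.1 (fun h2 => hy'B (h2 ▸ hz.2))
      · exact h.elim (fun h2 => hy'B (h2 ▸ hz.2)) hz.1
  · rintro ⟨hAE, hA, hA₀E, hA₀u, B₀, hB₀, hB₀A⟩
    obtain ⟨y, y', hyy', hyA⟩ : ∃ y y', ((y = x ∧ y' = x') ∨ (y = x' ∧ y' = x)) ∧ y ∈ A := by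
      rcases hA with h | h
      · exact ⟨x, x', Or.inl ⟨rfl, rfl⟩, h⟩
      · exact ⟨x', x, Or.inr ⟨rfl, rfl⟩, h⟩
    have hB₀E : B₀ ⊆ gr ((M.contract {x}).delete {x'}) := (PerFlat.mem_Uq.1 hB₀).1
    refine ⟨hAE, ?_, insert y B₀, ?_, ?_⟩
    · rw [rk_eq_iff _ hAE, eRk_eq_parallelMinor_add_one M hx hx' hxx' hAE hA, (rk_eq_iff _ hA₀E u).1 hA₀u]
      push_cast; rfl
    · exact (insert_mem_Uq_iff_parallel M hx hx' hxx' hne hyy' hB₀E).2 hB₀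
    · rw [Finset.coe_insert]
      exact Set.insert_subset hyA (hB₀A.trans Set.sdiff_subset)

omit [DecidableEq α] [M.Finite] in
/-- `(A₀ ∪ X) ∖ {x, x'} = A₀` for `A₀` avoiding the pair and `X ⊆ {x, x'}`. -/
lemma union_sdiff_pair {A₀ X : Set α} (hA₀ : A₀ ⊆ M.E \ {x, x'}) (hX : X ⊆ {x, x'}) :
    (A₀ ∪ X) \ {x, x'} = A₀ := by
  ext z
  simp only [Set.mem_sdiff, Set.mem_union]
  constructor
  · rintro ⟨hz | hz, hz'⟩
    · exact hz
    · exact absurd (hX hz) hz'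
  · intro hz
    exact ⟨Or.inl hz, (hA₀ hz).2⟩

omit [DecidableEq α] [M.Finite] in
/-- `(A₀ ∪ X) ∩ {x, x'} = X` for `A₀` avoiding the pair and `X ⊆ {x, x'}`. -/
lemma union_inter_pair {A₀ X : Set α} (hA₀ : A₀ ⊆ M.E \ {x, x'}) (hX : X ⊆ {x, x'}) :
    (A₀ ∪ X) ∩ {x, x'} = X := by
  ext z
  simp only [Set.mem_inter_iff, Set.mem_union]
  constructor
  · rintro ⟨hz | hz, hz'⟩
    · exact absurd hz' (hA₀ hz).2
    · exact hz
  · intro hz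
    exact ⟨Or.inr hz, hX hz⟩

omit [DecidableEq α] in
/-- The three non-empty parts of the pair, as a finset of sets. -/
lemma card_pair_parts (hne : x ≠ x') :
    ({{x}, {x'}, {x, x'}} : Finset (Set α)).card = 3 := by
  have h1 : ({x} : Set α) ≠ {x'} := fun h => hne (Set.singleton_eq_singleton_iff.1 h)
  have h2 : ({x} : Set α) ≠ {x, x'} := fun h => by
    have : x' ∈ ({x} : Set α) := h ▸ Set.mem_insert_of_mem _ rfl
    exact hne (Set.mem_singleton_iff.1 this).symm
  have h3 : ({x'} : Set α) ≠ {x, x'} := fun h => by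
    have : x ∈ ({x'} : Set α) := h ▸ Set.mem_insert _ _
    exact hne (Set.mem_singleton_iff.1 this)
  rw [Finset.card_insert_of_notMem, Finset.card_insert_of_notMem, Finset.card_singleton]
  · rw [Finset.mem_singleton]; exact h3
  · rw [Finset.mem_insert, Finset.mem_singleton]; exact fun h => h.elim h1 h2

/-- **A parallel pair splits the shadow exactly** (tight layer): `s_{u+1}(M; p+1, q+1) = 3·s_u(M ／ x ＼ x'; p, q)`. -/
theorem card_shadowLev_parallel {p q u : ℕ} (hn : (gr M).card = p + q + 2) (hx : M.IsNonloop x)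
    (hx' : M.IsNonloop x') (hxx' : x' ∈ M.closure {x}) (hne : x ≠ x') :
    (shadowLev M (u + 1) (PerFlat.Uq M (p + 1) (q + 1))).card =
      3 * (shadowLev ((M.contract {x}).delete {x'}) u
        (PerFlat.Uq ((M.contract {x}).delete {x'}) p q)).card := by
  rw [← card_pair_parts (x := x) (x' := x') hne, ← Finset.card_product]
  have hxE : x ∈ M.E := hx.mem_ground
  have hx'E : x' ∈ M.E := hx'.mem_ground
  have hpairE : ({x, x'} : Set α) ⊆ M.E := Set.insert_subset hxE (Set.singleton_subset_iff.2 hx'E)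
  refine Finset.card_nbij' (fun A => (A ∩ {x, x'}, A \ {x, x'})) (fun P => P.2 ∪ P.1) ?_ ?_ ?_ ?_
  · intro A hA
    rw [Finset.mem_coe] at hA
    obtain ⟨hAE, hxA, hA₀⟩ := (mem_shadowLev_parallel_iff M hn hx hx' hxx' hne).1 hA
    rw [Finset.mem_coe, Finset.mem_product]
    refine ⟨?_, hA₀⟩
    simp only [Finset.mem_insert, Finset.mem_singleton]
    by_cases h1 : x ∈ A <;> by_cases h2 : x' ∈ A
    · right; right
      exact Set.inter_eq_right.2 (Set.insert_subset h1 (Set.singleton_subset_iff.2 h2))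
    · left
      ext z
      simp only [Set.mem_inter_iff, Set.mem_insert_iff, Set.mem_singleton_iff]
      constructor
      · rintro ⟨hz, rfl | rfl⟩
        · rfl
        · exact absurd hz h2
      · rintro rfl; exact ⟨h1, Or.inl rfl⟩
    · right; left
      ext z
      simp only [Set.mem_inter_iff, Set.mem_insert_iff, Set.mem_singleton_iff]
      constructor
      · rintro ⟨hz, rfl | rfl⟩
        · exact absurd hz h1
        · rfl
      · rintro rfl; exact ⟨h2, Or.inr rfl⟩
    · exact absurd hxA (by rintro (h | h) <;> [exact h1 h; exact h2 h])
  · rintro ⟨X, A₀⟩ hP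
    rw [Finset.mem_coe, Finset.mem_product] at hP
    obtain ⟨hX, hA₀⟩ := hP
    have hA₀E : A₀ ⊆ M.E \ {x, x'} := by
      rw [← parallelMinor_ground]; exact ((mem_shadowLev _).1 hA₀).1
    have hXpair : X ⊆ {x, x'} ∧ (x ∈ X ∨ x' ∈ X) := by
      simp only [Finset.mem_insert, Finset.mem_singleton] at hX
      rcases hX with rfl | rfl | rfl
      · exact ⟨Set.singleton_subset_iff.2 (Set.mem_insert _ _), Or.inl rfl⟩
      · exact ⟨Set.singleton_subset_iff.2 (Set.mem_insert_of_mem _ rfl), Or.inr rfl⟩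
      · exact ⟨subset_refl _, Or.inl (Set.mem_insert _ _)⟩
    rw [Finset.mem_coe, mem_shadowLev_parallel_iff M hn hx hx' hxx' hne]
    refine ⟨Set.union_subset (hA₀E.trans Set.sdiff_subset) (hXpair.1.trans hpairE), ?_, ?_⟩
    · rcases hXpair.2 with h | h
      · exact Or.inl (Set.mem_union_right _ h)
      · exact Or.inr (Set.mem_union_right _ h)
    · rw [union_sdiff_pair M hA₀E hXpair.1]; exact hA₀
  · intro A _
    exact Set.sdiff_union_inter A {x, x'}
  · rintro ⟨X, A₀⟩ hP
    rw [Finset.mem_coe, Finset.mem_product] at hP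
    obtain ⟨hX, hA₀⟩ := hP
    have hA₀E : A₀ ⊆ M.E \ {x, x'} := by
      rw [← parallelMinor_ground]; exact ((mem_shadowLev _).1 hA₀).1
    have hXpair : X ⊆ {x, x'} := by
      simp only [Finset.mem_insert, Finset.mem_singleton] at hX
      rcases hX with rfl | rfl | rfl
      · exact Set.singleton_subset_iff.2 (Set.mem_insert _ _)
      · exact Set.singleton_subset_iff.2 (Set.mem_insert_of_mem _ rfl)
      · exact subset_refl _
    simp only
    rw [union_inter_pair M hA₀E hXpair, union_sdiff_pair M hA₀E hXpair]

/-- **THE PARALLEL-PAIR REDUCTION OF THE CUMULATIVE SHADOW INEQUALITY ON THE TIGHT LAYER.** If `M` has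
`p + q + 2` elements and a parallel pair `{x, x'}`, then `ShadowCumulative (M ／ x ＼ x') p q` gives
`ShadowCumulative M (p + 1) (q + 1)`: the shadow levels are `3·s_u(M ／ x ＼ x')`, and
`C(p+q+2, v+1)·C(p+q, q) ≤ C(p+q+2, q+1)·C(p+q, v)` for `q ≤ v ≤ p`. -/
theorem shadowCumulative_of_parallel {p q : ℕ} (hn : (gr M).card = p + q + 2) (hx : M.IsNonloop x)
    (hx' : M.IsNonloop x') (hxx' : x' ∈ M.closure {x}) (hne : x ≠ x')
    (hsc : ShadowCumulative ((M.contract {x}).delete {x'}) p q) : ShadowCumulative M (p + 1) (q + 1) := by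
  intro u hqu hup
  obtain ⟨v, rfl⟩ : ∃ v, u = v + 1 := ⟨u - 1, by omega⟩
  have hqv : q < v := by omega
  have hvp : v < p := by omega
  have h := hsc v hqv hvp
  rw [card_shadowLev_parallel M hn hx hx' hxx' hne, card_shadowLev_parallel M hn hx hx' hxx' hne]
  have hbin := choose_mul_choose_le_choose_mul_choose (m := p + q) (a := q) (b := v) hqv.le (by omega)
  have hN : p + 1 + (q + 1) = p + q + 2 := by ring
  rw [hN]
  have hpos : 0 < (p + q).choose q := Nat.choose_pos (by omega)
  set sq := (shadowLev ((M.contract {x}).delete {x'}) q (PerFlat.Uq ((M.contract {x}).delete {x'}) p q)).card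
  set sv := (shadowLev ((M.contract {x}).delete {x'}) v (PerFlat.Uq ((M.contract {x}).delete {x'}) p q)).card
  refine Nat.le_of_mul_le_mul_right ?_ hpos
  calc 3 * sq * (p + q + 2).choose (v + 1) * (p + q).choose q
      = 3 * sq * ((p + q + 2).choose (v + 1) * (p + q).choose q) := by ring
    _ ≤ 3 * sq * ((p + q + 2).choose (q + 1) * (p + q).choose v) := Nat.mul_le_mul_left _ hbin
    _ = 3 * (p + q + 2).choose (q + 1) * (sq * (p + q).choose v) := by ring
    _ ≤ 3 * (p + q + 2).choose (q + 1) * (sv * (p + q).choose q) := Nat.mul_le_mul_left _ h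
    _ = 3 * sv * (p + q + 2).choose (q + 1) * (p + q).choose q := by ring

end ParallelPair




end PercRepro.RankDist
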